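import Literature.NumberTheory.Sieve.BombieriVinogradovReduction
import Literature.NumberTheory.Sieve.VaughanMeanValue
import Literature.NumberTheory.LFunctions.PagePNTExpLevel
import HarnessLib

/-!
# The Bombieri–Vinogradov theorem over moduli coprime to the exceptional prime, with the saving
# `exp(−c√log x)` (Ford–Green–Konyagin–Maynard–Tao 2018, eq. (7.5))

Topic `Literature/NumberTheory/Sieve`; namespace `Literature.NumberTheory.Sieve`
(section `BombieriVinogradovCoprime`). Everything in this file is PROVED (theorems only).

Source: K. Ford, B. Green, S. Konyagin, J. Maynard, T. Tao, *Long gaps between primes*, J. Amer.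
Math. Soc. 31 (2018) 65–105 = arXiv:1412.5029v4, §7, proof of Lemma 7.2, display (7.5):
«… the Bombieri–Vinogradov theorem, modified slightly to take into account the exceptional
character: `∑_{q ≤ x^{1/2−ε}, (q,B)=1} max_{(a,q)=1} |ψ(z; q, a) − z/φ(q)| ≪ x exp(−c√log x)` …
(the standard proof, e.g. Davenport Ch. 28, with the Landau–Page zero-free region (7.4) for the
characters of conductor coprime to `B` in place of the Siegel–Walfisz theorem)».

The proof here IS Davenport's Ch. 28 argument as already formalised in the tree
(`BombieriVinogradovReduction.lean`: reduction to primitive characters, the weights `∑ 1/φ`, the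
large conductors by Vaughan's mean value theorem `vaughan_meanValue_holds`), run over the
divisor-closed set of moduli coprime to `B` (`sum_iSup_filter_le`), with the small conductors
`d ≤ D = e^T`, `(d, B) = 1`, `T = (c₁/14)√log x`, handled by the level-`T` prime number theorem
for progressions `PagePNTExpLevel.chebyshevPsiMod_bound_coprime` (saving `exp(−c₁√log z)` for
`z ≥ x^{(c₁/14)²}`, trivial bound below) instead of Siegel–Walfisz. Output: level `Q ≤ x^{9/20}`,
uniform heights `0 ≤ y_q ≤ x`, saving `exp(−(c₁/28)√log x)`, `B ≤ exp((c₁/14)√log x) ≤ e^{√log x}`.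

## Contents

* `sum_iSup_filter_le` — Steps A–C of the reduction summed over a divisor-closed set `G` of moduli.
* `primTerm_le_of_pointwise`, `psiSubSelfSup_le_of_pointwise` — `Φ(x; d) ≤ d E`, `P(x) ≤ 1 + E`
  from a pointwise bound `|ψ(N; d, a) − N/φ(d)| ≤ E` (`N ≤ x`).
* `self_mul_exp_neg_sqrt_log_mono` — `y e^{−c√log y}` is nondecreasing on `[e, ∞)` for `c ≤ 2`.
* `abs_chebyshevPsiMod_sub_le_of_expLevel` — the pointwise bound `E = K₁ D⁵ T x e^{−c₁√log x} + 6y₁`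
  for `d ≤ D ≤ e^T`, `(d, B) = 1`, from the level-`T` hypothesis (trivial below `y₁`, `√log y₁ ≥ T`).
* `sum_iSup_coprime_le_of_bounds` — the estimate under explicit side conditions on `x`.
* `bombieriVinogradov_coprime` — **FGKMT (7.5)**: absolute `c, K > 0` such that for all large `x`
  there is `B` (`= 1` or prime, `B ≤ e^{√log x}`) with
  `∑_{q ≤ Q, (q,B)=1} max_{(a,q)=1} |ψ(y_q; q, a) − y_q/φ(q)| ≤ K x exp(−c√log x)` for every
  `Q ≤ x^{9/20}` and all heights `0 ≤ y_q ≤ x`.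

## References

* K. Ford, B. Green, S. Konyagin, J. Maynard, T. Tao, *Long gaps between primes*, JAMS 31 (2018),
  §7, (7.5) [FordGreenKonyaginMaynardTao2018].
* H. Davenport, *Multiplicative Number Theory*, 2nd ed., GTM 74, Springer 1980, Ch. 28
  [DavenportMNT1980].
* A. C. Cojocaru, M. R. Murty, *An Introduction to Sieve Methods and their Applications*, CUP 2005,
  §9.2 [CojocaruMurty2005].
-/

noncomputable section

open Finset Real Filter
open scoped ArithmeticFunction.vonMangoldt

namespace Literature.NumberTheory.Sieve

section BombieriVinogradovCoprime
open scoped Classical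

/-! ### Steps A–C over a divisor-closed set of moduli -/

/-- Steps A–C of Davenport's reduction summed over the moduli `q ≤ Q` in a divisor-closed set `G`:
`∑_{q ≤ Q, q ∈ G} max_a |ψ(y_q; q, a) − y_q/φ(q)| ≤ W(Q) ∑_{d ≤ Q, d ∈ G} Φ(x; d) + ⌊log x/log 2⌋ Q log Q W(Q)`
(a primitive character inducing a character to a modulus in `G` has conductor in `G`).
[cite: DavenportMNT1980, Ch. 28 (reduction to primitive characters, (2)–(4))]
[cite: FordGreenKonyaginMaynardTao2018, §7 proof of Lemma 7.2, (7.5)] -/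
theorem sum_iSup_filter_le (Q : ℕ) {x : ℝ} (hx : 0 ≤ x) (y : ℕ → ℝ) (hy : ∀ q, 0 ≤ y q ∧ y q ≤ x)
    (G : ℕ → Prop) [DecidablePred G] (hG : ∀ q d : ℕ, G q → d ∣ q → G d) :
    ∑ q ∈ (Icc 1 Q).filter G,
        ⨆ a : (ZMod q)ˣ, |ParityWave0.chebyshevPsiMod q a (y q) - y q / Nat.totient q| ≤
      totientInvSum Q * ∑ d ∈ (Icc 1 Q).filter G, primTerm x d +
        ⌊Real.log x / Real.log 2⌋₊ * ((Q : ℝ) * Real.log Q * totientInvSum Q) := by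
  set F : ℕ → ℝ := fun d => ∑ χ ∈ (univ : Finset (DirichletCharacter ℂ d)).filter
    DirichletCharacter.IsPrimitive, majorant x ⟨d, χ⟩ with hF
  have hF0 : ∀ d, 0 ≤ F d := fun d => Finset.sum_nonneg fun _ _ => majorant_nonneg x _
  set F' : ℕ → ℝ := fun d => if G d then F d else 0 with hF'
  have hF'0 : ∀ d, 0 ≤ F' d := fun d => by
    simp only [hF']; split_ifs; exacts [hF0 d, le_rfl]
  have h1 : ∀ q ∈ (Icc 1 Q).filter G,
      ⨆ a : (ZMod q)ˣ, |ParityWave0.chebyshevPsiMod q a (y q) - y q / Nat.totient q| ≤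
      ((Nat.totient q : ℝ))⁻¹ * ∑ d ∈ q.divisors, F' d +
        ⌊Real.log x / Real.log 2⌋₊ * ((Q : ℝ) * Real.log Q) * ((Nat.totient q : ℝ))⁻¹ := by
    intro q hq
    rw [Finset.mem_filter] at hq
    have hq1 : 1 ≤ q := (Finset.mem_Icc.1 hq.1).1
    have hqQ : q ≤ Q := (Finset.mem_Icc.1 hq.1).2
    haveI : NeZero q := ⟨by omega⟩
    have hφ : 0 < (Nat.totient q : ℝ) := by exact_mod_cast Nat.totient_pos.2 hq1
    have hFF' : ∑ d ∈ q.divisors, F' d = ∑ d ∈ q.divisors, F d := by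
      refine Finset.sum_congr rfl fun d hd => ?_
      simp only [hF', if_pos (hG q d hq.2 (Nat.dvd_of_mem_divisors hd))]
    rw [hFF']
    refine (iSup_le_sum_primIndex q (hy q).1 (hy q).2).trans (add_le_add (le_of_eq ?_) ?_)
    · rw [primIndex, Finset.sum_sigma]
    · calc (q : ℝ) / Nat.totient q * nonCoprimePart q x
          ≤ (q : ℝ) / Nat.totient q * (⌊Real.log x / Real.log 2⌋₊ * Real.log q) :=
            mul_le_mul_of_nonneg_left (nonCoprimePart_le (by omega) hx) (by positivity)
        _ ≤ (Q : ℝ) / Nat.totient q * (⌊Real.log x / Real.log 2⌋₊ * Real.log Q) := by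
            gcongr
        _ = _ := by ring
  have h2 : ∀ q ∈ Icc 1 Q, 0 ≤ ((Nat.totient q : ℝ))⁻¹ * ∑ d ∈ q.divisors, F' d +
        ⌊Real.log x / Real.log 2⌋₊ * ((Q : ℝ) * Real.log Q) * ((Nat.totient q : ℝ))⁻¹ := by
    intro q hq
    have hq1 : 1 ≤ q := (Finset.mem_Icc.1 hq).1
    have hQ1 : (1 : ℝ) ≤ Q := by exact_mod_cast hq1.trans (Finset.mem_Icc.1 hq).2
    have : 0 ≤ Real.log Q := Real.log_nonneg hQ1
    have : 0 ≤ ∑ d ∈ q.divisors, F' d := Finset.sum_nonneg fun d _ => hF'0 d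
    positivity
  refine (Finset.sum_le_sum h1).trans ?_
  refine (Finset.sum_le_sum_of_subset_of_nonneg (Finset.filter_subset _ _)
    fun q hq _ => h2 q hq).trans ?_
  rw [Finset.sum_add_distrib, ← Finset.mul_sum, sum_mul_sum_divisors_eq Q]
  refine add_le_add ?_ (le_of_eq ?_)
  · calc ∑ d ∈ Icc 1 Q, F' d * ∑ q ∈ Icc 1 Q with d ∣ q, ((Nat.totient q : ℝ))⁻¹
        ≤ ∑ d ∈ Icc 1 Q, F' d * (((Nat.totient d : ℝ))⁻¹ * totientInvSum Q) :=
          Finset.sum_le_sum fun d hd => mul_le_mul_of_nonneg_left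
            (sum_filter_dvd_totient_inv_le Q (Finset.mem_Icc.1 hd).1) (hF'0 d)
      _ = totientInvSum Q * ∑ d ∈ Icc 1 Q, (if G d then primTerm x d else 0) := by
          rw [Finset.mul_sum]
          refine Finset.sum_congr rfl fun d _ => ?_
          simp only [hF']
          split_ifs
          · rw [primTerm]; ring
          · ring
      _ = totientInvSum Q * ∑ d ∈ (Icc 1 Q).filter G, primTerm x d := by
          rw [Finset.sum_filter]
  · rw [totientInvSum]; ring

/-! ### `Φ(x; d)` and `P(x)` from a pointwise bound -/

/-- For `2 ≤ d`: a pointwise bound `|ψ(N; d, a) − N/φ(d)| ≤ E` for all `N ≤ x`, `(a, d) = 1` gives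
`Φ(x; d) ≤ d E` (via `ψ(y, χ) = ∑_a χ(a)(ψ(y; d, a) − y/φ(d))` for `χ ≠ χ₀`).
[cite: DavenportMNT1980, Ch. 28 (the small conductors)] -/
theorem primTerm_le_of_pointwise {x E : ℝ} (hx : 0 ≤ x) (hE : 0 ≤ E) {d : ℕ} (hd : 2 ≤ d)
    (h : ∀ (a : (ZMod d)ˣ) (N : ℕ), (N : ℝ) ≤ x →
      |ParityWave0.chebyshevPsiMod d a N - N / Nat.totient d| ≤ E) :
    primTerm x d ≤ d * E := by
  haveI : NeZero d := ⟨by omega⟩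
  have hφ : 0 < (Nat.totient d : ℝ) := by exact_mod_cast Nat.totient_pos.2 (by omega)
  have h1 : ∀ χ ∈ (univ : Finset (DirichletCharacter ℂ d)).filter DirichletCharacter.IsPrimitive,
      majorant x ⟨d, χ⟩ ≤ Nat.totient d * E := by
    intro χ hχ
    have hprim : χ.IsPrimitive := (Finset.mem_filter.1 hχ).2
    have hne : χ ≠ 1 := by
      intro h
      rw [h, DirichletCharacter.isPrimitive_def, DirichletCharacter.conductor_one] at hprim
      omega
    rw [majorant, if_neg (show ¬ d = 1 by omega)]
    refine chebyshevPsiCharSup_le χ (fun N hN => ?_) hx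
    refine (norm_chebyshevPsiChar_le_sum_units hne N).trans ?_
    calc ∑ a : (ZMod d)ˣ, |ParityWave0.chebyshevPsiMod d a N - N / Nat.totient d|
        ≤ ∑ _a : (ZMod d)ˣ, E := Finset.sum_le_sum fun a _ => h a N hN
      _ = Nat.totient d * E := by
          rw [Finset.sum_const, nsmul_eq_mul, Finset.card_univ, ZMod.card_units_eq_totient]
  have hcard : (((univ : Finset (DirichletCharacter ℂ d)).filter
      DirichletCharacter.IsPrimitive).card : ℝ) ≤ Nat.totient d := by
    have := (Finset.card_filter_le (univ : Finset (DirichletCharacter ℂ d))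
      DirichletCharacter.IsPrimitive)
    rw [Finset.card_univ, ← Nat.card_eq_fintype_card,
      DirichletCharacter.card_eq_totient_of_hasEnoughRootsOfUnity ℂ d] at this
    exact_mod_cast this
  calc primTerm x d ≤ ((Nat.totient d : ℝ))⁻¹ * ∑ _χ ∈ (univ : Finset
        (DirichletCharacter ℂ d)).filter DirichletCharacter.IsPrimitive, (Nat.totient d * E) := by
        rw [primTerm]
        exact mul_le_mul_of_nonneg_left (Finset.sum_le_sum h1) (inv_nonneg.2 hφ.le)
    _ = ((univ : Finset (DirichletCharacter ℂ d)).filter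
          DirichletCharacter.IsPrimitive).card * E := by
        rw [Finset.sum_const, nsmul_eq_mul]; field_simp
    _ ≤ Nat.totient d * E := by gcongr
    _ ≤ d * E := by gcongr; exact_mod_cast Nat.totient_le d

/-- `P(x) ≤ 1 + E` from `|ψ(N) − N| ≤ E` for all `N ≤ x`. [cite: DavenportMNT1980, Ch. 28 (the term d = 1)] -/
theorem psiSubSelfSup_le_of_pointwise {x E : ℝ} (hx : 0 ≤ x)
    (h : ∀ N : ℕ, (N : ℝ) ≤ x → |Chebyshev.psi N - N| ≤ E) : psiSubSelfSup x ≤ 1 + E := by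
  rw [psiSubSelfSup]
  gcongr
  refine Finset.sup'_le _ _ fun N hN => h N ?_
  exact (Nat.cast_le.2 (Nat.lt_succ_iff.1 (mem_range.1 hN))).trans (Nat.floor_le hx)

/-! ### The pointwise bound for the small conductors -/

/-- `y e^{−c√log y} ≤ x e^{−c√log x}` for `e ≤ y ≤ x` and `0 ≤ c ≤ 2` (the function
`u − c√u` is nondecreasing for `u ≥ 1`). [cite: DavenportMNT1980, Ch. 28 (monotonicity of the error term)] -/
theorem self_mul_exp_neg_sqrt_log_mono {c : ℝ} (hc : c ≤ 2) {y x : ℝ}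
    (hy : Real.exp 1 ≤ y) (hyx : y ≤ x) :
    y * Real.exp (-(c * Real.sqrt (Real.log y))) ≤
      x * Real.exp (-(c * Real.sqrt (Real.log x))) := by
  have hy0 : 0 < y := (Real.exp_pos 1).trans_le hy
  have hx0 : 0 < x := hy0.trans_le hyx
  have hly : 1 ≤ Real.log y := by
    rw [← Real.log_exp 1]; exact Real.log_le_log (Real.exp_pos 1) hy
  have hlyx : Real.log y ≤ Real.log x := Real.log_le_log hy0 hyx
  set a := Real.sqrt (Real.log y) with ha
  set b := Real.sqrt (Real.log x) with hb
  have ha1 : 1 ≤ a := by rw [ha, ← Real.sqrt_one]; exact Real.sqrt_le_sqrt hly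
  have hab : a ≤ b := Real.sqrt_le_sqrt hlyx
  have ha2 : a ^ 2 = Real.log y := Real.sq_sqrt (by linarith)
  have hb2 : b ^ 2 = Real.log x := Real.sq_sqrt (by linarith)
  have key : Real.log y - c * a ≤ Real.log x - c * b := by
    rw [← ha2, ← hb2]
    nlinarith [mul_nonneg (sub_nonneg.2 hab) (show 0 ≤ b + a - c by linarith)]
  calc y * Real.exp (-(c * a)) = Real.exp (Real.log y - c * a) := by
        rw [Real.exp_sub, Real.exp_log hy0, Real.exp_neg, div_eq_mul_inv]
    _ ≤ Real.exp (Real.log x - c * b) := Real.exp_le_exp.2 key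
    _ = x * Real.exp (-(c * b)) := by
        rw [Real.exp_sub, Real.exp_log hx0, Real.exp_neg, div_eq_mul_inv]

/-- `0 ≤ ψ(y; q, a) ≤ ψ(y) ≤ (log 4 + 4) y`, hence `|ψ(y; q, a) − y/φ(q)| ≤ 6 y` for `y ≥ 0`.
[cite: DavenportMNT1980, Ch. 28 (the trivial bound for small y)] -/
theorem abs_chebyshevPsiMod_sub_le_six_mul {q : ℕ} (hq : 1 ≤ q) (a : ZMod q) {y : ℝ}
    (hy : 0 ≤ y) : |ParityWave0.chebyshevPsiMod q a y - y / Nat.totient q| ≤ 6 * y := by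
  have hφ : (1 : ℝ) ≤ Nat.totient q := by exact_mod_cast Nat.totient_pos.2 hq
  have h1 : 0 ≤ ParityWave0.chebyshevPsiMod q a y :=
    Finset.sum_nonneg fun n _ => ArithmeticFunction.vonMangoldt.residueClass_nonneg a n
  have h2 : ParityWave0.chebyshevPsiMod q a y ≤ Chebyshev.psi y := by
    rw [ParityWave0.chebyshevPsiMod, Chebyshev.psi, sum_range_succ_eq_sum_Ioc' _ (by simp)]
    exact Finset.sum_le_sum fun n _ => ArithmeticFunction.vonMangoldt.residueClass_le _ n
  have h3 : Chebyshev.psi y ≤ (Real.log 4 + 4) * y := Chebyshev.psi_le_const_mul_self hy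
  have h4 : Real.log 4 ≤ 2 := by
    have h44 : Real.log 4 = 2 * Real.log 2 := by
      rw [show (4:ℝ) = 2^2 by norm_num, Real.log_pow]; norm_num
    have := Real.log_two_lt_d9; linarith
  have h5 : 0 ≤ y / Nat.totient q := by positivity
  have h6 : y / Nat.totient q ≤ y := div_le_self hy hφ
  rw [abs_le]; constructor <;> nlinarith

/-- The pointwise bound for the small conductors: if every `d ≥ 1` with `log d ≤ T`, `(d, B) = 1`
satisfies `|ψ(z; d, a) − z/φ(d)| ≤ K₁ d⁵ T z e^{−c₁√log z}/φ(d)` for `z ≥ 64`, `√log z ≥ T`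
(the level-`T` prime number theorem, `PagePNTExpLevel.chebyshevPsiMod_bound_coprime`), then for
`1 ≤ d ≤ D ≤ e^T`, `(d, B) = 1` and integers `N ≤ x`:
`|ψ(N; d, a) − N/φ(d)| ≤ K₁ D⁵ T x e^{−c₁√log x} + 6 y₁`, where `64 ≤ y₁ ≤ x`, `√log y₁ ≥ T`
(trivial bound below `y₁`, monotonicity of `z e^{−c₁√log z}` above).
[cite: FordGreenKonyaginMaynardTao2018, §7 proof of Lemma 7.2, (7.4)–(7.5)] -/
theorem abs_chebyshevPsiMod_sub_le_of_expLevel {c₁ K₁ T x y₁ : ℝ} {D B : ℕ}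
    (hc₁1 : c₁ ≤ 1) (hK₁ : 0 ≤ K₁) (hT : 0 ≤ T) (hy₁ : 64 ≤ y₁) (hy₁x : y₁ ≤ x)
    (hTy₁ : T ≤ Real.sqrt (Real.log y₁)) (hD : (D : ℝ) ≤ Real.exp T)
    (hψ : ∀ (d : ℕ) [NeZero d], Real.log d ≤ T → d.Coprime B →
      ∀ (a : (ZMod d)ˣ) (z : ℝ), 64 ≤ z → T ≤ Real.sqrt (Real.log z) →
        |ParityWave0.chebyshevPsiMod d a z - z / Nat.totient d| ≤
          K₁ * (d : ℝ) ^ 5 * T * z * Real.exp (-(c₁ * Real.sqrt (Real.log z))) / Nat.totient d)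
    {d : ℕ} (hd1 : 1 ≤ d) (hdD : d ≤ D) (hdB : d.Coprime B) (a : (ZMod d)ˣ) {N : ℕ}
    (hNx : (N : ℝ) ≤ x) :
    |ParityWave0.chebyshevPsiMod d a N - N / Nat.totient d| ≤
      K₁ * (D : ℝ) ^ 5 * T * x * Real.exp (-(c₁ * Real.sqrt (Real.log x))) + 6 * y₁ := by
  haveI : NeZero d := ⟨by omega⟩
  have hx0 : 0 < x := by linarith
  have hE1 : 0 ≤ K₁ * (D : ℝ) ^ 5 * T * x * Real.exp (-(c₁ * Real.sqrt (Real.log x))) := by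
    positivity
  rcases lt_or_ge (N : ℝ) y₁ with hN | hN
  · -- trivial range
    have := abs_chebyshevPsiMod_sub_le_six_mul hd1 (a : ZMod d) (Nat.cast_nonneg N)
    linarith
  · -- the level-`T` prime number theorem
    have hN64 : (64 : ℝ) ≤ N := hy₁.trans hN
    have hy₁0 : 0 < y₁ := by linarith
    have hTN : T ≤ Real.sqrt (Real.log N) :=
      hTy₁.trans (Real.sqrt_le_sqrt (Real.log_le_log hy₁0 hN))
    have hd0 : (0 : ℝ) < d := by exact_mod_cast hd1
    have hdD' : (d : ℝ) ≤ D := by exact_mod_cast hdD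
    have hlogd : Real.log d ≤ T := by
      calc Real.log d ≤ Real.log (Real.exp T) := Real.log_le_log hd0 (hdD'.trans hD)
        _ = T := Real.log_exp T
    have hφ : (1 : ℝ) ≤ Nat.totient d := by exact_mod_cast Nat.totient_pos.2 hd1
    have hb := hψ d hlogd hdB a N hN64 hTN
    have hnum : 0 ≤ K₁ * (d : ℝ) ^ 5 * T * N * Real.exp (-(c₁ * Real.sqrt (Real.log N))) := by
      positivity
    have he : Real.exp 1 ≤ (N : ℝ) := by
      have := Real.exp_one_lt_d9; linarith
    have hmono := self_mul_exp_neg_sqrt_log_mono (c := c₁) (by linarith) he hNx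
    calc |ParityWave0.chebyshevPsiMod d a N - N / Nat.totient d|
        ≤ K₁ * (d : ℝ) ^ 5 * T * N * Real.exp (-(c₁ * Real.sqrt (Real.log N))) / Nat.totient d :=
          hb
      _ ≤ K₁ * (d : ℝ) ^ 5 * T * N * Real.exp (-(c₁ * Real.sqrt (Real.log N))) :=
          div_le_self hnum hφ
      _ = K₁ * (d : ℝ) ^ 5 * T * (N * Real.exp (-(c₁ * Real.sqrt (Real.log N)))) := by ring
      _ ≤ K₁ * (D : ℝ) ^ 5 * T * (x * Real.exp (-(c₁ * Real.sqrt (Real.log x)))) := by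
          gcongr
      _ = K₁ * (D : ℝ) ^ 5 * T * x * Real.exp (-(c₁ * Real.sqrt (Real.log x))) := by ring
      _ ≤ _ := le_add_of_nonneg_right (by positivity)

/-! ### The estimate under explicit side conditions -/

set_option maxHeartbeats 1600000 in
/-- **FGKMT (7.5) under explicit side conditions.** With `u = √log x`, `T = (c₁/14) u`,
`D = ⌊e^T⌋`: if `u ≥ 112/c₁`, `u ≥ 3`, `u¹⁴ ≤ exp((c₁/28) u)`, and the level-`T` prime number
theorem holds for the moduli coprime to `B`, then for `Q ≤ x^{9/20}` and heights `0 ≤ y_q ≤ x`: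
`∑_{q ≤ Q, (q,B)=1} max_a |ψ(y_q; q, a) − y_q/φ(q)| ≤ (2K₁ + 96C₁ + 15) x exp(−(c₁/28)√log x)`.
[cite: FordGreenKonyaginMaynardTao2018, §7 proof of Lemma 7.2, (7.5)]
[cite: DavenportMNT1980, Ch. 28] -/
theorem sum_iSup_coprime_le_of_bounds {c₁ K₁ C₁ : ℝ} (hc₁ : 0 < c₁) (hc₁1 : c₁ ≤ 1)
    (hK₁ : 0 ≤ K₁) (hC₁ : 0 ≤ C₁) (hV : VaughanBound C₁) {x : ℝ} (hx : 1 < x)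
    (hu1 : 112 / c₁ ≤ Real.sqrt (Real.log x)) (hu3 : 3 ≤ Real.sqrt (Real.log x))
    (hu4 : Real.sqrt (Real.log x) ^ 14 ≤ Real.exp (c₁ / 28 * Real.sqrt (Real.log x)))
    {B : ℕ}
    (hψ : ∀ (d : ℕ) [NeZero d], Real.log d ≤ c₁ / 14 * Real.sqrt (Real.log x) → d.Coprime B →
      ∀ (a : (ZMod d)ˣ) (z : ℝ), 64 ≤ z → c₁ / 14 * Real.sqrt (Real.log x) ≤ Real.sqrt (Real.log z) →
        |ParityWave0.chebyshevPsiMod d a z - z / Nat.totient d| ≤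
          K₁ * (d : ℝ) ^ 5 * (c₁ / 14 * Real.sqrt (Real.log x)) * z *
            Real.exp (-(c₁ * Real.sqrt (Real.log z))) / Nat.totient d)
    {Q : ℕ} (hQ : (Q : ℝ) ≤ x ^ (9 / 20 : ℝ)) (y : ℕ → ℝ) (hy : ∀ q, 0 ≤ y q ∧ y q ≤ x) :
    ∑ q ∈ (Icc 1 Q).filter (fun q => Nat.Coprime q B),
        ⨆ a : (ZMod q)ˣ, |ParityWave0.chebyshevPsiMod q a (y q) - y q / Nat.totient q| ≤
      (2 * K₁ + 96 * C₁ + 15) * x * Real.exp (-(c₁ / 28 * Real.sqrt (Real.log x))) := by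
  have hx0 : 0 < x := by linarith
  have hx1 : 1 ≤ x := hx.le
  -- notation
  set L := Real.log x with hLdef
  set u := Real.sqrt L with hudef
  set T := c₁ / 14 * u with hTdef
  set D := ⌊Real.exp T⌋₊ with hDdef
  set θ₁ : ℝ := (c₁ / 14) ^ 2 with hθ₁def
  set y₁ := x ^ θ₁ with hy₁def
  set E := K₁ * (D : ℝ) ^ 5 * T * x * Real.exp (-(c₁ * u)) + 6 * y₁ with hEdef
  set M := x * Real.exp (-T) with hMdef
  set N19 := x ^ (19 / 20 : ℝ) with hN19def
  -- basic facts about `L`, `u`, `T`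
  have hL0 : 0 < L := Real.log_pos hx
  have hu0 : 0 < u := by linarith
  have huL : u ^ 2 = L := Real.sq_sqrt hL0.le
  have hu1' : 1 ≤ u := by linarith
  have huL' : u ≤ L := by
    have h := le_self_pow₀ hu1' two_ne_zero; rwa [huL] at h
  have hL1 : 1 ≤ L := hu1'.trans huL'
  have hL9 : 9 ≤ L := by
    have h := mul_le_mul hu3 hu3 (by norm_num) hu0.le
    have h' : u * u = L := by rw [← huL]; ring
    linarith
  have hc14 : c₁ / 14 ≤ 1 / 14 := by linarith
  have hc140 : 0 < c₁ / 14 := by positivity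
  have hcu : 0 ≤ c₁ * u := by positivity
  have hcu1 : c₁ * u ≤ u := mul_le_of_le_one_left hu0.le hc₁1
  have hu3u : 3 * u ≤ L := by
    have h := mul_le_mul_of_nonneg_right hu3 hu0.le
    have h' : u * u = L := by rw [← huL]; ring
    linarith
  have hT8 : 8 ≤ T := by
    have h1 : c₁ / 14 * (112 / c₁) = 8 := by field_simp; ring
    rw [hTdef, ← h1]; exact mul_le_mul_of_nonneg_left hu1 hc140.le
  have hT0 : 0 ≤ T := by linarith
  have hT1 : 1 ≤ T := by linarith
  have hTu : T ≤ u / 14 := by rw [hTdef]; linarith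
  have hTu' : T ≤ u := by linarith
  have hTL : T ≤ L := hTu'.trans huL'
  have hxexp : ∀ θ : ℝ, x ^ θ = Real.exp (L * θ) := fun θ => Real.rpow_def_of_pos hx0 θ
  have hxL : x = Real.exp L := (Real.exp_log hx0).symm
  -- facts about `D`
  have heT2 : (2 : ℝ) ≤ Real.exp T := by linarith [Real.add_one_le_exp T]
  have hD2 : 2 ≤ D := Nat.le_floor (by exact_mod_cast heT2)
  have hD1 : 1 ≤ D := by omega
  have hDle : (D : ℝ) ≤ Real.exp T := Nat.floor_le (Real.exp_pos T).le
  have hDlt : Real.exp T < D + 1 := Nat.lt_floor_add_one _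
  have hD0 : (0 : ℝ) ≤ D := Nat.cast_nonneg D
  -- facts about `y₁`
  have hθ₁0 : 0 < θ₁ := by positivity
  have hθ₁1 : θ₁ ≤ 1 / 196 := by
    calc θ₁ = (c₁ / 14) ^ 2 := hθ₁def
      _ ≤ (1 / 14) ^ 2 := pow_le_pow_left₀ hc140.le hc14 2
      _ = 1 / 196 := by norm_num
  have hy₁0 : 0 < y₁ := Real.rpow_pos_of_pos hx0 θ₁
  have hy₁x : y₁ ≤ x := by
    calc y₁ ≤ x ^ (1 : ℝ) := Real.rpow_le_rpow_of_exponent_le hx1 (by linarith)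
      _ = x := Real.rpow_one x
  have hlogy₁ : Real.log y₁ = θ₁ * L := by rw [hy₁def, Real.log_rpow hx0]
  have hTsq : θ₁ * L = T ^ 2 := by rw [hθ₁def, hTdef, ← huL]; ring
  have hsqy₁ : Real.sqrt (Real.log y₁) = T := by
    rw [hlogy₁, hTsq, Real.sqrt_sq hT0]
  have hy₁64 : 64 ≤ y₁ := by
    have h1 : y₁ = Real.exp (T ^ 2) := by rw [← Real.exp_log hy₁0, hlogy₁, hTsq]
    rw [h1]
    have h2 : 64 ≤ T ^ 2 := by
      have h := mul_le_mul hT8 hT8 (by norm_num) hT0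
      have h' : T * T = T ^ 2 := by ring
      linarith
    linarith [Real.add_one_le_exp (T ^ 2)]
  have hx64 : 64 ≤ x := hy₁64.trans hy₁x
  have hx2 : 2 ≤ x := by linarith
  -- the pointwise bound `E`
  have hE0 : 0 ≤ E := by positivity
  have hpt : ∀ d : ℕ, 1 ≤ d → d ≤ D → Nat.Coprime d B → ∀ (a : (ZMod d)ˣ) (N : ℕ), (N : ℝ) ≤ x →
      |ParityWave0.chebyshevPsiMod d a N - N / Nat.totient d| ≤ E := by
    intro d hd1 hdD hdG a N hNx
    have := abs_chebyshevPsiMod_sub_le_of_expLevel (B := B) hc₁1 hK₁ hT0 hy₁64 hy₁x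
      hsqy₁.ge hDle (fun d _ hld hdB a z hz hTz => hψ d hld hdB a z hz hTz) hd1 hdD hdG a hNx
    exact this
  -- `Φ(x;1) ≤ 1 + E` and `Φ(x;d) ≤ D E` for `2 ≤ d ≤ D`, `(d,B) = 1`
  have hE1 : primTerm x 1 ≤ 1 + E := by
    refine (primTerm_one_le x).trans (psiSubSelfSup_le_of_pointwise hx0.le fun N hN => ?_)
    have := hpt 1 le_rfl hD1 (Nat.coprime_one_left B) 1 N hN
    simpa [ParityWave0.chebyshevPsiMod_one, Nat.totient_one] using this
  have hE2 : ∀ d : ℕ, 2 ≤ d → d ≤ D → Nat.Coprime d B → primTerm x d ≤ D * E := by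
    intro d hd2 hdD hdG
    calc primTerm x d ≤ d * E :=
          primTerm_le_of_pointwise hx0.le hE0 hd2 fun a N hN => hpt d (by omega) hdD hdG a N hN
      _ ≤ D * E := mul_le_mul_of_nonneg_right (by exact_mod_cast hdD) hE0
  -- Steps A–C over the coprime moduli
  have hGdiv : ∀ q d : ℕ, Nat.Coprime q B → d ∣ q → Nat.Coprime d B := fun q d hq hdq =>
    Nat.Coprime.coprime_dvd_left hdq hq
  have hAC := sum_iSup_filter_le Q hx0.le y hy (fun q => Nat.Coprime q B) hGdiv
  -- splitting the `d`-sum at `D`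
  set S := (Icc 1 Q).filter (fun q => Nat.Coprime q B) with hSdef
  have hsplit : ∑ d ∈ S, primTerm x d ≤ (1 + E) + D * (D * E) + ∑ d ∈ Ioc D Q, primTerm x d := by
    rw [← Finset.sum_filter_add_sum_filter_not S (fun d => d ≤ D)]
    refine add_le_add ?_ ?_
    · -- small conductors
      set g : ℕ → ℝ := fun d => if d = 1 then 1 + E else D * E with hgdef
      have hg0 : ∀ d, 0 ≤ g d := fun d => by
        simp only [hgdef]; split_ifs <;> positivity
      have h1 : ∀ d ∈ S.filter (fun d => d ≤ D), primTerm x d ≤ g d := by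
        intro d hd
        simp only [hSdef, Finset.mem_filter, Finset.mem_Icc] at hd
        obtain ⟨⟨⟨hd1, -⟩, hdG⟩, hdD⟩ := hd
        by_cases hd1' : d = 1
        · subst hd1'; simp only [hgdef, if_true]; exact hE1
        · simp only [hgdef, if_neg hd1']; exact hE2 d (by omega) hdD hdG
      have hsub : S.filter (fun d => d ≤ D) ⊆ Icc 1 D := by
        intro d hd
        simp only [hSdef, Finset.mem_filter, Finset.mem_Icc] at hd
        exact Finset.mem_Icc.2 ⟨hd.1.1.1, hd.2⟩
      calc ∑ d ∈ S.filter (fun d => d ≤ D), primTerm x d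
          ≤ ∑ d ∈ S.filter (fun d => d ≤ D), g d := Finset.sum_le_sum h1
        _ ≤ ∑ d ∈ Icc 1 D, g d := Finset.sum_le_sum_of_subset_of_nonneg hsub fun d _ _ => hg0 d
        _ = g 1 + ∑ d ∈ Ioc 1 D, g d := by
            rw [Finset.Icc_eq_cons_Ioc hD1, Finset.sum_cons]
        _ = (1 + E) + ∑ d ∈ Ioc 1 D, (D : ℝ) * E := by
            have hg1 : g 1 = 1 + E := by simp [hgdef]
            have hg2 : ∀ d ∈ Ioc 1 D, g d = (D : ℝ) * E := fun d hd => by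
              have : d ≠ 1 := by have := (Finset.mem_Ioc.1 hd).1; omega
              simp [hgdef, this]
            rw [hg1, Finset.sum_congr rfl hg2]
        _ ≤ (1 + E) + D * (D * E) := by
            rw [Finset.sum_const, nsmul_eq_mul, Nat.card_Ioc]
            gcongr
            exact_mod_cast Nat.sub_le D 1
    · -- large conductors: drop the coprimality condition
      refine Finset.sum_le_sum_of_subset_of_nonneg (fun d hd => ?_) fun d _ _ => primTerm_nonneg x d
      simp only [hSdef, Finset.mem_filter, Finset.mem_Icc, not_le] at hd
      exact Finset.mem_Ioc.2 ⟨hd.2, hd.1.1.2⟩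
  -- exponent comparisons
  have hM0 : 0 ≤ M := by positivity
  have hN19_1 : 1 ≤ N19 := Real.one_le_rpow hx1 (by norm_num)
  have hN19_0 : 0 ≤ N19 := by linarith
  have hexpT : Real.exp (7 * T) * Real.exp (-(c₁ * u)) ≤ Real.exp (-T) := by
    rw [← Real.exp_add]; refine Real.exp_le_exp.2 ?_; rw [hTdef]; linarith
  have hE1M : K₁ * (D : ℝ) ^ 5 * T * x * Real.exp (-(c₁ * u)) ≤ K₁ * L * M := by
    have h5 : (D : ℝ) ^ 5 ≤ Real.exp (7 * T) := by
      calc (D : ℝ) ^ 5 ≤ Real.exp T ^ 5 := by gcongr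
        _ = Real.exp (5 * T) := by rw [← Real.exp_nat_mul]; norm_num
        _ ≤ Real.exp (7 * T) := Real.exp_le_exp.2 (by linarith)
    calc K₁ * (D : ℝ) ^ 5 * T * x * Real.exp (-(c₁ * u))
        = K₁ * T * x * ((D : ℝ) ^ 5 * Real.exp (-(c₁ * u))) := by ring
      _ ≤ K₁ * L * x * (Real.exp (7 * T) * Real.exp (-(c₁ * u))) := by gcongr
      _ ≤ K₁ * L * x * Real.exp (-T) := by gcongr
      _ = K₁ * L * M := by rw [hMdef]; ring
  have hDDE1 : (D : ℝ) * (D * (K₁ * (D : ℝ) ^ 5 * T * x * Real.exp (-(c₁ * u)))) ≤ K₁ * L * M := by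
    have h7 : (D : ℝ) * (D * (D : ℝ) ^ 5) ≤ Real.exp (7 * T) := by
      calc (D : ℝ) * (D * (D : ℝ) ^ 5) = (D : ℝ) ^ 7 := by ring
        _ ≤ Real.exp T ^ 7 := by gcongr
        _ = Real.exp (7 * T) := by rw [← Real.exp_nat_mul]; norm_num
    calc (D : ℝ) * (D * (K₁ * (D : ℝ) ^ 5 * T * x * Real.exp (-(c₁ * u))))
        = K₁ * T * x * ((D : ℝ) * (D * (D : ℝ) ^ 5) * Real.exp (-(c₁ * u))) := by ring
      _ ≤ K₁ * L * x * (Real.exp (7 * T) * Real.exp (-(c₁ * u))) := by gcongr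
      _ ≤ K₁ * L * x * Real.exp (-T) := by gcongr
      _ = K₁ * L * M := by rw [hMdef]; ring
  have hy₁N : y₁ ≤ N19 := by
    rw [hy₁def, hN19def]
    exact Real.rpow_le_rpow_of_exponent_le hx1 (by linarith)
  have hDDy₁ : (D : ℝ) * (D * (6 * y₁)) ≤ 6 * N19 := by
    have h2 : (D : ℝ) * D ≤ Real.exp (2 * T) := by
      calc (D : ℝ) * D = (D : ℝ) ^ 2 := by ring
        _ ≤ Real.exp T ^ 2 := by gcongr
        _ = Real.exp (2 * T) := by rw [← Real.exp_nat_mul]; norm_num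
    have h3 : Real.exp (2 * T) * y₁ ≤ N19 := by
      rw [hy₁def, hN19def, hxexp, hxexp, ← Real.exp_add]
      refine Real.exp_le_exp.2 ?_
      have hLθ : L * θ₁ ≤ L * (1 / 196) := mul_le_mul_of_nonneg_left hθ₁1 hL0.le
      linarith
    calc (D : ℝ) * (D * (6 * y₁)) = 6 * ((D : ℝ) * D * y₁) := by ring
      _ ≤ 6 * (Real.exp (2 * T) * y₁) := by gcongr
      _ ≤ 6 * N19 := by gcongr
  -- the small-conductor total
  have hsmall : (1 + E) + D * (D * E) ≤ 1 + 2 * (K₁ * L * M) + 12 * N19 := by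
    have e1 : (D : ℝ) * (D * E) = D * (D * (K₁ * (D : ℝ) ^ 5 * T * x * Real.exp (-(c₁ * u)))) +
        D * (D * (6 * y₁)) := by rw [hEdef]; ring
    rw [e1, hEdef]
    linarith [hE1M, hDDE1, hDDy₁, hy₁N]
  -- the large conductors
  have hlarge : ∑ d ∈ Ioc D Q, primTerm x d ≤ 32 * C₁ * L ^ 4 * M + 64 * C₁ * L ^ 5 * N19 := by
    rcases le_or_gt Q D with hQD | hDQ
    · rw [Finset.Ioc_eq_empty (by omega), Finset.sum_empty]; positivity
    · have hQ1 : 1 ≤ Q := by omega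
      have hQ1' : (1 : ℝ) ≤ Q := by exact_mod_cast hQ1
      have hQx : (Q : ℝ) ≤ x := hQ.trans (by
        calc x ^ (9 / 20 : ℝ) ≤ x ^ (1 : ℝ) := Real.rpow_le_rpow_of_exponent_le hx1 (by norm_num)
          _ = x := Real.rpow_one x)
      have hlogQ : Real.log Q ≤ 9 / 20 * L := by
        calc Real.log Q ≤ Real.log (x ^ (9 / 20 : ℝ)) := Real.log_le_log (by linarith) hQ
          _ = 9 / 20 * L := by rw [Real.log_rpow hx0]
      have hlogQ0 : 0 ≤ Real.log Q := Real.log_nonneg hQ1'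
      have hLQ : Real.log (x * Q) ≤ 2 * L := by
        rw [Real.log_mul hx0.ne' (by positivity)]; linarith
      have hLQ0 : 0 ≤ Real.log (x * Q) := Real.log_nonneg (one_le_mul_of_one_le_of_one_le hx1 hQ1')
      have hLQ4 : Real.log (x * Q) ^ 4 ≤ 16 * L ^ 4 := by
        calc Real.log (x * Q) ^ 4 ≤ (2 * L) ^ 4 := pow_le_pow_left₀ hLQ0 hLQ 4
          _ = 16 * L ^ 4 := by ring
      have hE4 := sum_Ioc_primTerm_le hC₁ hV hx2 hQ1 hD1
      -- the six terms of the bracket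
      have hDQ' : (D : ℝ) + 1 ≤ Q := by exact_mod_cast hDQ
      have t1 : x / (Q + 1) ≤ M := by
        rw [hMdef, Real.exp_neg, ← div_eq_mul_inv]
        exact div_le_div_of_nonneg_left hx0.le (Real.exp_pos T) (by linarith)
      have t4 : x / (D + 1) ≤ M := by
        rw [hMdef, Real.exp_neg, ← div_eq_mul_inv]
        exact div_le_div_of_nonneg_left hx0.le (Real.exp_pos T) hDlt.le
      have t2 : x ^ (5 / 6 : ℝ) ≤ N19 := Real.rpow_le_rpow_of_exponent_le hx1 (by norm_num)
      have t3 : x ^ (1 / 2 : ℝ) * Q ≤ N19 := by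
        calc x ^ (1 / 2 : ℝ) * Q ≤ x ^ (1 / 2 : ℝ) * x ^ (9 / 20 : ℝ) := by gcongr
          _ = N19 := by rw [hN19def, ← Real.rpow_add hx0]; norm_num
      have t5 : x ^ (5 / 6 : ℝ) * (1 + Real.log Q) ≤ L * N19 := by
        have : 1 + Real.log Q ≤ L := by linarith
        calc x ^ (5 / 6 : ℝ) * (1 + Real.log Q) ≤ N19 * L := by gcongr
          _ = L * N19 := mul_comm _ _
      have hbr : x / (Q + 1) + x ^ (5 / 6 : ℝ) + x ^ (1 / 2 : ℝ) * Q +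
          (x / (D + 1) + x ^ (5 / 6 : ℝ) * (1 + Real.log Q) + x ^ (1 / 2 : ℝ) * Q) ≤
            2 * M + 4 * (L * N19) := by
        have : N19 ≤ L * N19 := le_mul_of_one_le_left hN19_0 hL1
        linarith
      have hbr0 : 0 ≤ x / (Q + 1) + x ^ (5 / 6 : ℝ) + x ^ (1 / 2 : ℝ) * Q +
          (x / (D + 1) + x ^ (5 / 6 : ℝ) * (1 + Real.log Q) + x ^ (1 / 2 : ℝ) * Q) := by positivity
      calc ∑ d ∈ Ioc D Q, primTerm x d ≤ _ := hE4
        _ ≤ C₁ * (16 * L ^ 4) * (2 * M + 4 * (L * N19)) :=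
            mul_le_mul (mul_le_mul_of_nonneg_left hLQ4 hC₁) hbr hbr0 (by positivity)
        _ = 32 * C₁ * L ^ 4 * M + 64 * C₁ * L ^ 5 * N19 := by ring
  -- the weights and the remainder term
  have hQN : (Q : ℝ) ≤ N19 :=
    hQ.trans (Real.rpow_le_rpow_of_exponent_le hx1 (by norm_num))
  have hlogQL : Real.log Q ≤ L := by
    rcases Nat.eq_zero_or_pos Q with hQ0 | hQpos
    · rw [hQ0]; simp; exact hL0.le
    · calc Real.log Q ≤ Real.log (x ^ (9 / 20 : ℝ)) :=
            Real.log_le_log (by exact_mod_cast hQpos) hQ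
        _ = 9 / 20 * L := by rw [Real.log_rpow hx0]
        _ ≤ L := by linarith
  have hlogQ0 : 0 ≤ Real.log Q := Real.log_natCast_nonneg Q
  have hW : totientInvSum Q ≤ L ^ 2 := by
    refine (totientInvSum_le Q).trans (pow_le_pow_left₀ (by linarith) ?_ 2)
    rcases Nat.eq_zero_or_pos Q with hQ0 | hQpos
    · rw [hQ0]; simp; exact hL1
    · have : Real.log Q ≤ 9 / 20 * L := by
        calc Real.log Q ≤ Real.log (x ^ (9 / 20 : ℝ)) :=
              Real.log_le_log (by exact_mod_cast hQpos) hQ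
          _ = 9 / 20 * L := by rw [Real.log_rpow hx0]
      linarith
  have hW0 : 0 ≤ totientInvSum Q := totientInvSum_nonneg Q
  have hR : (⌊L / Real.log 2⌋₊ : ℝ) * ((Q : ℝ) * Real.log Q * totientInvSum Q) ≤ 2 * L ^ 4 * N19 := by
    have hlog2 : (1 : ℝ) / 2 ≤ Real.log 2 := by
      have := Real.log_two_gt_d9; linarith
    have hfl : (⌊L / Real.log 2⌋₊ : ℝ) ≤ 2 * L := by
      refine (Nat.floor_le (by positivity)).trans ?_
      rw [div_le_iff₀ (by positivity)]
      have h := mul_le_mul_of_nonneg_left hlog2 (by positivity : (0 : ℝ) ≤ 2 * L)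
      linarith
    have hQW : (Q : ℝ) * Real.log Q * totientInvSum Q ≤ N19 * L * L ^ 2 :=
      mul_le_mul (mul_le_mul hQN hlogQL hlogQ0 hN19_0) hW hW0 (by positivity)
    have hQW0 : 0 ≤ (Q : ℝ) * Real.log Q * totientInvSum Q := by positivity
    calc (⌊L / Real.log 2⌋₊ : ℝ) * ((Q : ℝ) * Real.log Q * totientInvSum Q)
        ≤ 2 * L * (N19 * L * L ^ 2) := mul_le_mul hfl hQW hQW0 (by positivity)
      _ = 2 * L ^ 4 * N19 := by ring
  -- powers of `L`
  have hLpow : ∀ {m n : ℕ}, m ≤ n → L ^ m ≤ L ^ n := fun h => pow_le_pow_right₀ hL1 h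
  have hL7u : L ^ 7 = u ^ 14 := by rw [← huL]; ring
  have hL7 : L ^ 7 ≤ Real.exp (c₁ / 28 * u) := by rw [hL7u]; exact hu4
  -- (C5') `L⁷ N19 ≤ M` and (C4') `L⁷ M ≤ x e^{−(c₁/28) u}`, `M ≤ x e^{−(c₁/28) u}`
  have hC5 : L ^ 7 * N19 ≤ M := by
    calc L ^ 7 * N19 ≤ Real.exp (c₁ / 28 * u) * N19 := by gcongr
      _ = Real.exp (c₁ / 28 * u + L * (19 / 20)) := by rw [hN19def, hxexp, Real.exp_add]
      _ ≤ Real.exp (L + -T) := by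
          refine Real.exp_le_exp.2 ?_
          rw [hTdef]; linarith
      _ = M := by rw [Real.exp_add, ← hxL]
  have hC4 : L ^ 7 * M ≤ x * Real.exp (-(c₁ / 28 * u)) := by
    calc L ^ 7 * M ≤ Real.exp (c₁ / 28 * u) * M := by gcongr
      _ = x * (Real.exp (c₁ / 28 * u) * Real.exp (-T)) := by rw [hMdef]; ring
      _ = x * Real.exp (-(c₁ / 28 * u)) := by
          rw [← Real.exp_add]; congr 1; congr 1; rw [hTdef]; ring
  have hMx : M ≤ x * Real.exp (-(c₁ / 28 * u)) := by
    rw [hMdef]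
    refine mul_le_mul_of_nonneg_left (Real.exp_le_exp.2 ?_) hx0.le
    rw [hTdef]; linarith
  -- assembling
  have hS0 : 0 ≤ ∑ d ∈ S, primTerm x d := Finset.sum_nonneg fun d _ => primTerm_nonneg x d
  have hSum : ∑ d ∈ S, primTerm x d ≤
      1 + 2 * (K₁ * L * M) + 12 * N19 + (32 * C₁ * L ^ 4 * M + 64 * C₁ * L ^ 5 * N19) :=
    hsplit.trans (add_le_add hsmall hlarge)
  have hmain : totientInvSum Q * ∑ d ∈ S, primTerm x d +
      (⌊L / Real.log 2⌋₊ : ℝ) * ((Q : ℝ) * Real.log Q * totientInvSum Q) ≤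
        (2 * K₁ + 32 * C₁) * (L ^ 7 * M) + (15 + 64 * C₁) * (L ^ 7 * N19) := by
    have h1 : totientInvSum Q * ∑ d ∈ S, primTerm x d ≤
        L ^ 2 + 2 * K₁ * (L ^ 3 * M) + 12 * (L ^ 2 * N19) + 32 * C₁ * (L ^ 6 * M) +
          64 * C₁ * (L ^ 7 * N19) :=
      (mul_le_mul hW hSum hS0 (by positivity)).trans (le_of_eq (by ring))
    have h27 : L ^ 2 ≤ L ^ 7 := hLpow (by norm_num)
    have h37 : L ^ 3 ≤ L ^ 7 := hLpow (by norm_num)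
    have h47 : L ^ 4 ≤ L ^ 7 := hLpow (by norm_num)
    have h67 : L ^ 6 ≤ L ^ 7 := hLpow (by norm_num)
    have hL70 : 0 ≤ L ^ 7 := by positivity
    have a1 : L ^ 2 ≤ L ^ 7 * N19 :=
      h27.trans (le_mul_of_one_le_right hL70 hN19_1)
    have a2 : K₁ * (L ^ 3 * M) ≤ K₁ * (L ^ 7 * M) :=
      mul_le_mul_of_nonneg_left (mul_le_mul_of_nonneg_right h37 hM0) hK₁
    have a3 : L ^ 2 * N19 ≤ L ^ 7 * N19 := mul_le_mul_of_nonneg_right h27 hN19_0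
    have a4 : C₁ * (L ^ 6 * M) ≤ C₁ * (L ^ 7 * M) :=
      mul_le_mul_of_nonneg_left (mul_le_mul_of_nonneg_right h67 hM0) hC₁
    have a6 : L ^ 4 * N19 ≤ L ^ 7 * N19 := mul_le_mul_of_nonneg_right h47 hN19_0
    linarith [a1, a2, a3, a4, a6, hR, h1]
  calc ∑ q ∈ S, ⨆ a : (ZMod q)ˣ, |ParityWave0.chebyshevPsiMod q a (y q) - y q / Nat.totient q|
      ≤ _ := hAC
    _ ≤ (2 * K₁ + 32 * C₁) * (L ^ 7 * M) + (15 + 64 * C₁) * (L ^ 7 * N19) := hmain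
    _ ≤ (2 * K₁ + 32 * C₁) * (x * Real.exp (-(c₁ / 28 * u))) +
          (15 + 64 * C₁) * (x * Real.exp (-(c₁ / 28 * u))) :=
        add_le_add (mul_le_mul_of_nonneg_left hC4 (by positivity))
          (mul_le_mul_of_nonneg_left (hC5.trans hMx) (by positivity))
    _ = (2 * K₁ + 96 * C₁ + 15) * x * Real.exp (-(c₁ / 28 * u)) := by ring

/-! ### The eventual side conditions; FGKMT (7.5) -/

/-- **Ford–Green–Konyagin–Maynard–Tao (7.5): Bombieri–Vinogradov over the moduli coprime to the
exceptional prime, saving `exp(−c√log x)`**, given the level-`T` prime number theorem for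
progressions in the form of `PagePNTExpLevel.chebyshevPsiMod_bound_coprime` (hypothesis `hPage`):
there are absolute `c, K > 0` such that for all large `x` there is `B : ℕ`, `B = 1` or `B` prime,
`B ≤ e^{√log x}`, with `∑_{q ≤ Q, (q,B)=1} max_{(a,q)=1} |ψ(y_q; q, a) − y_q/φ(q)| ≤ K x e^{−c√log x}`
for every `Q ≤ x^{9/20}` and all heights `0 ≤ y_q ≤ x`.
[cite: FordGreenKonyaginMaynardTao2018, §7 proof of Lemma 7.2, (7.5)] -/
theorem bombieriVinogradov_coprime_of_expLevel {c₁ K₁ : ℝ} (hc₁ : 0 < c₁) (hc₁1 : c₁ ≤ 1)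
    (hK₁ : 0 < K₁)
    (hPage : ∀ T : ℝ, 1 ≤ T → ∃ B : ℕ, (B = 1 ∨ B.Prime) ∧ (B : ℝ) ≤ Real.exp T ∧
      ∀ (q : ℕ) [NeZero q], Real.log q ≤ T → q.Coprime B → ∀ (a : (ZMod q)ˣ) (x : ℝ), 64 ≤ x →
        T ≤ Real.sqrt (Real.log x) →
          |ParityWave0.chebyshevPsiMod q a x - x / Nat.totient q| ≤
            K₁ * (q : ℝ) ^ 5 * T * x * Real.exp (-(c₁ * Real.sqrt (Real.log x))) / Nat.totient q) :
    ∃ c : ℝ, 0 < c ∧ ∃ K : ℝ, 0 < K ∧ ∀ᶠ x : ℝ in atTop,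
      ∃ B : ℕ, (B = 1 ∨ B.Prime) ∧ (B : ℝ) ≤ Real.exp (Real.sqrt (Real.log x)) ∧
        ∀ Q : ℕ, (Q : ℝ) ≤ x ^ (9 / 20 : ℝ) → ∀ y : ℕ → ℝ, (∀ q, 0 ≤ y q ∧ y q ≤ x) →
          ∑ q ∈ (Icc 1 Q).filter (fun q => Nat.Coprime q B),
              ⨆ a : (ZMod q)ˣ, |ParityWave0.chebyshevPsiMod q a (y q) - y q / Nat.totient q| ≤
            K * x * Real.exp (-(c * Real.sqrt (Real.log x))) := by
  obtain ⟨C₁, hC₁, hV⟩ := vaughanBound_of_vaughan_meanValue vaughan_meanValue_holds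
  refine ⟨c₁ / 28, by positivity, 2 * K₁ + 96 * C₁ + 15, by positivity, ?_⟩
  have hs : Tendsto (fun x : ℝ => Real.sqrt (Real.log x)) atTop atTop :=
    Real.tendsto_sqrt_atTop.comp Real.tendsto_log_atTop
  have h14 : ∀ᶠ u : ℝ in atTop, u ^ 14 ≤ Real.exp (c₁ / 28 * u) := by
    filter_upwards [(isLittleO_pow_exp_pos_mul_atTop 14 (by positivity : 0 < c₁ / 28)).eventuallyLE,
      eventually_ge_atTop 0] with u hu hu0
    rwa [Real.norm_of_nonneg (pow_nonneg hu0 14), Real.norm_of_nonneg (Real.exp_pos _).le] at hu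
  filter_upwards [eventually_gt_atTop 1, hs.eventually (eventually_ge_atTop (112 / c₁)),
    hs.eventually (eventually_ge_atTop 3), hs.eventually h14] with x hx hu1 hu3 hu4
  set u := Real.sqrt (Real.log x) with hu
  set T := c₁ / 14 * u with hT
  have hc140 : 0 < c₁ / 14 := by positivity
  have hT8 : 8 ≤ T := by
    have h1 : c₁ / 14 * (112 / c₁) = 8 := by field_simp; ring
    rw [hT, ← h1]; exact mul_le_mul_of_nonneg_left hu1 hc140.le
  have hu0 : 0 ≤ u := by linarith
  obtain ⟨B, hB, hBT, hgood⟩ := hPage T (by linarith)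
  refine ⟨B, hB, hBT.trans (Real.exp_le_exp.2 ?_), fun Q hQ y hy => ?_⟩
  · rw [hT]; nlinarith
  · exact sum_iSup_coprime_le_of_bounds hc₁ hc₁1 hK₁.le hC₁ hV hx hu1 hu3 hu4
      (fun d _ hld hdB a z hz hTz => hgood d hld hdB a z hz hTz) hQ y hy

/-- **Ford–Green–Konyagin–Maynard–Tao 2018, (7.5): the Bombieri–Vinogradov theorem over the
moduli coprime to the Landau–Page exceptional prime, with the saving `exp(−c√log x)`.**
There are absolute constants `c, K > 0` such that for all sufficiently large `x` there is `B : ℕ`,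
`B = 1` or `B` prime, `B ≤ e^{√log x}`, such that for every `Q ≤ x^{9/20}` and all heights
`0 ≤ y_q ≤ x`:
`∑_{q ≤ Q, (q, B) = 1} max_{(a, q) = 1} |ψ(y_q; q, a) − y_q/φ(q)| ≤ K x exp(−c√log x)`.
(`B` is the exceptional prime of `PagePNTExpLevel.chebyshevPsiMod_bound_coprime` at level
`T = (c₁/14)√log x`, i.e. the least prime factor of the conductor of the possible exceptional real
character of modulus `≤ e^T`; the level `9/20 < 1/2` and the uniformity in the heights are what
the application in [FGKMT18, Lemma 7.2] uses.)
[cite: FordGreenKonyaginMaynardTao2018, §7 proof of Lemma 7.2, (7.5)]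
[cite: DavenportMNT1980, Ch. 28] -/
theorem bombieriVinogradov_coprime :
    ∃ c : ℝ, 0 < c ∧ ∃ K : ℝ, 0 < K ∧ ∀ᶠ x : ℝ in atTop,
      ∃ B : ℕ, (B = 1 ∨ B.Prime) ∧ (B : ℝ) ≤ Real.exp (Real.sqrt (Real.log x)) ∧
        ∀ Q : ℕ, (Q : ℝ) ≤ x ^ (9 / 20 : ℝ) → ∀ y : ℕ → ℝ, (∀ q, 0 ≤ y q ∧ y q ≤ x) →
          ∑ q ∈ (Icc 1 Q).filter (fun q => Nat.Coprime q B),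
              ⨆ a : (ZMod q)ˣ, |ParityWave0.chebyshevPsiMod q a (y q) - y q / Nat.totient q| ≤
            K * x * Real.exp (-(c * Real.sqrt (Real.log x))) := by
  obtain ⟨c₁, hc₁, hc₁1, K₁, hK₁, hPage⟩ :=
    Literature.NumberTheory.LFunctions.PagePNTExpLevel.chebyshevPsiMod_bound_coprime
  exact bombieriVinogradov_coprime_of_expLevel hc₁ hc₁1 hK₁ fun T hT => hPage T hT

end BombieriVinogradovCoprime

end Literature.NumberTheory.Sieve
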